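import Mathlib.LinearAlgebra.Matrix.Kronecker
import Literature.Computability.AlgebraicComplexity.BorderRankCWKoszulRanks
import Literature.Computability.AlgebraicComplexity.CwSquareFlattening
import HarnessLib

/-!
# The `p = 1` Koszul flattening of `φ₂(T_{cw,q}^{⊠2})` as a sum of Kronecker products

Topic `Literature/Computability/AlgebraicComplexity`.  First step of the proof of the named fact
`CGLV2022_thm33_koszulRank` (`BorderRankCWKoszulRanks.lean`; Conner–Gesmundo–Landsberg–Ventura,
*Rank and border rank of Kronecker powers of tensors and Strassen's laser method*, comput.
complexity 31 (2022), Thm. 3.3 (proof)): the matrix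
`K_q = koszulFlattening 1 (cglvPhi2 q) (T_{cw,q}^{⊠2})` — rows `Λ²A' ⊗ C^{⊗2}`, columns
`A' ⊗ B^{⊗2 *}`, `A' = ⟨e₀, e₁, e₂⟩` — is, after relabelling pair indices, the sum of Kronecker
products

  `K_q ≅ ∑_{j=0}^{2} Inc_j ⊗ Φ_j`,  `Φ₀ = (D + G₁) ⊗ (D + G₁)`, `Φ₁ = D ⊗ S + S ⊗ D − D ⊗ D`,
  `Φ₂ = D ⊗ G₂ + G₂ ⊗ D + G₂ ⊗ G₁ + G₃ ⊗ G₃`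

(`koszulFlattening_cglvPhi2_reindex`), where `Inc_j : Λ¹ → Λ²` is the signed incidence of
`e_j ∧ ·` and, on `V = K^{q+1}` with indices `(c, b)` (row = `C`-index, column = `B`-index),
`D(c,b) = [b = c ≠ 0]`, `G_a(c,b) = [(c,b) ∈ {(a,0),(0,a)}]`, `S(c,b) = [T_{cw,q}(·,b,c) ≠ 0]`
(the slices of `T_{cw,q}`: `S = ∑_{a ≥ 0} G_a`, `G₀ = D`).  This only unfolds the definitions: the
slice of `T_{cw,q}^{⊠2}` at `(b, c)` is `a_{α(b₀,c₀) α(b₁,c₁)}` (`cwAlpha`), and the three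
coordinates of `φ₂(a_{xy})` (CGLV, proof of Thm. 3.3) are the indicators `[x ≤ 1][y ≤ 1]`,
`[x = 0 ∨ y = 0]`, `[(x,y) ∈ {(0,2),(2,0),(2,1),(3,3)}]` (`cglvPhi2_eq_phi2Val`).
Everything here is PROVED; the sequel (`CwSquareKoszulBasis.lean`) block-diagonalises the `Φ_j`.

## References

* A. Conner, F. Gesmundo, J. M. Landsberg, E. Ventura, comput. complexity 31 (2022) =
  arXiv:1909.04785, Thm. 3.3 and its proof (the projection `φ₂`), §3.5 (second proof).
  [ConnerGesmundoLandsbergVentura2022]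
-/

noncomputable section

open scoped BigOperators Kronecker
open Matrix

namespace Literature.Computability.AlgebraicComplexity

namespace CGLVThm33

variable (R : Type*) [CommRing R] (q : ℕ)

/-! ## The slice matrices `D`, `G_a`, `S` of `T_{cw,q}` -/

/-- `D(c,b) = [b = c ≠ 0]` (`= [α(b,c) = 0]`: the slice `T_{cw,q}(a₀^*)`), indices `(c, b)`.
[cite: ConnerGesmundoLandsbergVentura2022, eq. (1)] -/
def opD : Matrix (Fin (q + 1)) (Fin (q + 1)) R :=
  fun c b => if (b : ℕ) = c ∧ (b : ℕ) ≠ 0 then 1 else 0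

/-- `G_a(c,b) = [(b,c) ∈ {(0,a),(a,0)}]` (`= [α(b,c) = a]` for `a ≥ 1`: the slice
`T_{cw,q}(a_a^*) = b₀ ⊗ c_a + b_a ⊗ c₀`). [cite: ConnerGesmundoLandsbergVentura2022, eq. (1)] -/
def opG (a : ℕ) : Matrix (Fin (q + 1)) (Fin (q + 1)) R :=
  fun c b => if ((b : ℕ) = 0 ∧ (c : ℕ) = a) ∨ ((c : ℕ) = 0 ∧ (b : ℕ) = a) then 1 else 0

/-- `S(c,b) = [α(b,c) is defined] = [b = c ≠ 0] + [b = 0 ≠ c] + [c = 0 ≠ b]` (the support of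
`T_{cw,q}` seen from `B ⊗ C`; `S = ∑_a T_{cw,q}(a_a^*)`). [cite: ConnerGesmundoLandsbergVentura2022, eq. (1)] -/
def opS : Matrix (Fin (q + 1)) (Fin (q + 1)) R :=
  fun c b => if ((b : ℕ) = c ∧ (b : ℕ) ≠ 0) ∨ ((b : ℕ) = 0 ∧ (c : ℕ) ≠ 0) ∨ ((c : ℕ) = 0 ∧ (b : ℕ) ≠ 0)
    then 1 else 0

/-- The signed incidence matrix of `e_j ∧ · : Λ¹K³ → Λ²K³` (rows `T`, columns `S`):
`[j ∉ S, T = S ∪ {j}] ε(S, j)`. [folklore] -/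
def incMat (j : Fin 3) : Matrix (PSub 3 2) (PSub 3 1) R :=
  fun T S => if j ∉ S.1 ∧ T.1 = insert j S.1 then (koszulSign S.1 j : R) else 0

/-- `Φ₀ = (D + G₁) ⊗ (D + G₁)` (coefficient of `e₀`). [cite: ConnerGesmundoLandsbergVentura2022, Thm. 3.3 (proof)] -/
def Phi0 : Matrix (Fin (q + 1) × Fin (q + 1)) (Fin (q + 1) × Fin (q + 1)) R :=
  (opD R q + opG R q 1) ⊗ₖ (opD R q + opG R q 1)

/-- `Φ₁ = D ⊗ S + S ⊗ D − D ⊗ D` (coefficient of `e₁`). [cite: ConnerGesmundoLandsbergVentura2022, Thm. 3.3 (proof)] -/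
def Phi1 : Matrix (Fin (q + 1) × Fin (q + 1)) (Fin (q + 1) × Fin (q + 1)) R :=
  opD R q ⊗ₖ opS R q + opS R q ⊗ₖ opD R q - opD R q ⊗ₖ opD R q

/-- `Φ₂ = D ⊗ G₂ + G₂ ⊗ D + G₂ ⊗ G₁ + G₃ ⊗ G₃` (coefficient of `e₂`). [cite: ConnerGesmundoLandsbergVentura2022, Thm. 3.3 (proof)] -/
def Phi2 : Matrix (Fin (q + 1) × Fin (q + 1)) (Fin (q + 1) × Fin (q + 1)) R :=
  opD R q ⊗ₖ opG R q 2 + opG R q 2 ⊗ₖ opD R q + opG R q 2 ⊗ₖ opG R q 1 + opG R q 3 ⊗ₖ opG R q 3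

/-- `Φ_j` for `j = 0, 1, 2`. [cite: ConnerGesmundoLandsbergVentura2022, Thm. 3.3 (proof)] -/
def PhiJ (j : Fin 3) : Matrix (Fin (q + 1) × Fin (q + 1)) (Fin (q + 1) × Fin (q + 1)) R :=
  if (j : ℕ) = 0 then Phi0 R q else if (j : ℕ) = 1 then Phi1 R q else Phi2 R q

/-- The Kronecker form `∑_j Inc_j ⊗ Φ_j` of the flattening, rows `Λ² × (C × C)`, columns
`Λ¹ × (B × B)`. [cite: ConnerGesmundoLandsbergVentura2022, Thm. 3.3 (proof)] -/
def Kx : Matrix (PSub 3 2 × (Fin (q + 1) × Fin (q + 1))) (PSub 3 1 × (Fin (q + 1) × Fin (q + 1))) R :=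
  ∑ j : Fin 3, incMat R j ⊗ₖ PhiJ R q j

/-! ## The coordinates of `φ₂` -/

/-- The three coordinates of `φ₂(a_{xy})` as indicators: `[x ≤ 1 ∧ y ≤ 1]`, `[x = 0 ∨ y = 0]`,
`[(x,y) ∈ {(0,2),(2,0),(2,1),(3,3)}]`. [cite: ConnerGesmundoLandsbergVentura2022, Thm. 3.3 (proof)] -/
def phi2Val (j : Fin 3) (x y : ℕ) : R :=
  if (j : ℕ) = 0 then (if x ≤ 1 ∧ y ≤ 1 then 1 else 0)
  else if (j : ℕ) = 1 then (if x = 0 ∨ y = 0 then 1 else 0)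
  else (if (x = 0 ∧ y = 2) ∨ (x = 2 ∧ y = 0) ∨ (x = 2 ∧ y = 1) ∨ (x = 3 ∧ y = 3) then 1 else 0)

/-- The value `φ₂`-coordinate `j` of the slice at a pair of (possibly undefined) `α`-values:
`φ_j(x, y)` if both are defined, else `0`. [cite: ConnerGesmundoLandsbergVentura2022, Thm. 3.3 (proof)] -/
def sliceVal (j : Fin 3) : Option (Fin (q + 1)) → Option (Fin (q + 1)) → R
  | some x, some y => phi2Val R j x y
  | none, _ => 0
  | some _, none => 0

variable {R q}

/-- `φ₂` in indicator form. [cite: ConnerGesmundoLandsbergVentura2022, Thm. 3.3 (proof)] -/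
theorem cglvPhi2_eq_phi2Val (j : Fin 3) (a : Fin 2 → Fin (q + 1)) :
    cglvPhi2 R q j a = phi2Val R j (a 0) (a 1) := by
  simp only [cglvPhi2, Matrix.of_apply, phi2Val]
  generalize ((a 0 : Fin (q + 1)) : ℕ) = x
  generalize ((a 1 : Fin (q + 1)) : ℕ) = y
  rcases j with ⟨j, hj⟩
  have : j = 0 ∨ j = 1 ∨ j = 2 := by omega
  rcases this with rfl | rfl | rfl <;> simp <;> split_ifs <;> first | rfl | omega

/-! ## Slices of `T_{cw,q}^{⊠2}` -/

/-- The four cases of `α(b,c)`: `0` if `b = c ≠ 0`, `c` if `b = 0 ≠ c`, `b` if `c = 0 ≠ b`,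
undefined otherwise. [cite: ConnerGesmundoLandsbergVentura2022, eq. (1)] -/
theorem cwAlpha_cases (b c : Fin (q + 1)) :
    ((b : ℕ) = c ∧ (b : ℕ) ≠ 0 ∧ cwAlpha q b c = some 0) ∨
    ((b : ℕ) = 0 ∧ (c : ℕ) ≠ 0 ∧ cwAlpha q b c = some c) ∨
    ((c : ℕ) = 0 ∧ (b : ℕ) ≠ 0 ∧ (b : ℕ) ≠ c ∧ cwAlpha q b c = some b) ∨
    (¬ ((b : ℕ) = c ∧ (b : ℕ) ≠ 0) ∧ ¬ ((b : ℕ) = 0 ∧ (c : ℕ) ≠ 0) ∧ ¬ ((c : ℕ) = 0 ∧ (b : ℕ) ≠ 0) ∧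
      cwAlpha q b c = none) := by
  unfold cwAlpha
  simp only [ne_eq, Fin.ext_iff, Fin.val_zero]
  by_cases h1 : (b : ℕ) = c ∧ ¬ (b : ℕ) = 0
  · exact Or.inl ⟨h1.1, h1.2, by rw [if_pos h1]⟩
  by_cases h2 : (b : ℕ) = 0 ∧ ¬ (c : ℕ) = 0
  · exact Or.inr (Or.inl ⟨h2.1, h2.2, by rw [if_neg h1, if_pos h2]⟩)
  by_cases h3 : (c : ℕ) = 0 ∧ ¬ (b : ℕ) = 0
  · refine Or.inr (Or.inr (Or.inl ⟨h3.1, h3.2, fun h => h1 ⟨h, h3.2⟩, ?_⟩))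
    rw [if_neg h1, if_neg h2, if_pos h3]
  · refine Or.inr (Or.inr (Or.inr ⟨h1, h2, h3, ?_⟩))
    rw [if_neg h1, if_neg h2, if_neg h3]

/-- `D(c,b) = [α(b,c) = 0]`. [cite: ConnerGesmundoLandsbergVentura2022, eq. (1)] -/
theorem opD_eq (b c : Fin (q + 1)) :
    opD R q c b = match cwAlpha q b c with | some x => (if (x : ℕ) = 0 then 1 else 0) | none => 0 := by
  rcases cwAlpha_cases b c with ⟨h1, h2, h⟩ | ⟨h1, h2, h⟩ | ⟨h1, h2, h3, h⟩ | ⟨h1, h2, h3, h⟩ <;>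
    rw [h] <;> simp only [opD]
  · rw [if_pos ⟨h1, h2⟩, if_pos (Fin.val_zero _)]
  · have hc : ¬ ((b : ℕ) = c ∧ (b : ℕ) ≠ 0) := fun h' => h'.2 h1
    rw [if_neg hc, if_neg h2]
  · rw [if_neg (fun h' => h3 h'.1), if_neg h2]
  · rw [if_neg h1]

/-- `G_a(c,b) = [α(b,c) = a]` for `a ≥ 1`. [cite: ConnerGesmundoLandsbergVentura2022, eq. (1)] -/
theorem opG_eq {a : ℕ} (ha : a ≠ 0) (b c : Fin (q + 1)) :
    opG R q a c b = match cwAlpha q b c with | some x => (if (x : ℕ) = a then 1 else 0) | none => 0 := by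
  rcases cwAlpha_cases b c with ⟨h1, h2, h⟩ | ⟨h1, h2, h⟩ | ⟨h1, h2, h3, h⟩ | ⟨h1, h2, h3, h⟩ <;>
    rw [h] <;> simp only [opG]
  · rw [if_neg, Fin.val_zero, if_neg (fun h' => ha h'.symm)]
    rintro (⟨h', -⟩ | ⟨h', -⟩)
    · exact h2 h'
    · exact h2 (h1.trans h')
  · by_cases hc : (c : ℕ) = a
    · rw [if_pos (Or.inl ⟨h1, hc⟩), if_pos hc]
    · rw [if_neg, if_neg hc]
      rintro (⟨-, h'⟩ | ⟨h', -⟩)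
      · exact hc h'
      · exact h2 h'
  · by_cases hb : (b : ℕ) = a
    · rw [if_pos (Or.inr ⟨h1, hb⟩), if_pos hb]
    · rw [if_neg, if_neg hb]
      rintro (⟨h', -⟩ | ⟨-, h'⟩)
      · exact h2 h'
      · exact hb h'
  · rw [if_neg]
    rintro (⟨hb, hc⟩ | ⟨hc, hb⟩)
    · exact h2 ⟨hb, fun h' => ha (hc.symm.trans h')⟩
    · exact h3 ⟨hc, fun h' => ha (hb.symm.trans h')⟩

/-- `S(c,b) = [α(b,c) defined]`. [cite: ConnerGesmundoLandsbergVentura2022, eq. (1)] -/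
theorem opS_eq (b c : Fin (q + 1)) :
    opS R q c b = match cwAlpha q b c with | some _ => 1 | none => 0 := by
  rcases cwAlpha_cases b c with ⟨h1, h2, h⟩ | ⟨h1, h2, h⟩ | ⟨h1, h2, h3, h⟩ | ⟨h1, h2, h3, h⟩ <;>
    rw [h] <;> simp only [opS]
  · rw [if_pos (Or.inl ⟨h1, h2⟩)]
  · rw [if_pos (Or.inr (Or.inl ⟨h1, h2⟩))]
  · rw [if_pos (Or.inr (Or.inr ⟨h1, h2⟩))]
  · rw [if_neg]
    rintro (h' | h' | h')
    · exact h1 h'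
    · exact h2 h'
    · exact h3 h'

/-- **Slice formula** for `Fin 2`-indexed pairs: `∑_a M_{j,a} (T_{cw,q}^{⊠2})_{a b c}` is
`M_{j,(x,y)}` if `α(b₀,c₀) = x` and `α(b₁,c₁) = y` are both defined, and `0` otherwise.
[cite: ConnerGesmundoLandsbergVentura2022, §3.3] -/
theorem sum_mul_kroneckerPow_two (M : Matrix (Fin 3) (Fin 2 → Fin (q + 1)) R) (j : Fin 3)
    (b c : Fin 2 → Fin (q + 1)) :
    ∑ a, M j a * kroneckerPow (cwTensor R q) 2 a b c =
      match cwAlpha q (b 0) (c 0), cwAlpha q (b 1) (c 1) with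
      | some x, some y => M j ![x, y]
      | _, _ => 0 := by
  have key : ∀ a : Fin 2 → Fin (q + 1), kroneckerPow (cwTensor R q) 2 a b c =
      (if cwAlpha q (b 0) (c 0) = some (a 0) then 1 else 0) *
        (if cwAlpha q (b 1) (c 1) = some (a 1) then 1 else 0) := by
    intro a
    rw [kroneckerPow_apply, Fin.prod_univ_two, cwTensor_eq_ite_cwAlpha, cwTensor_eq_ite_cwAlpha]
  simp_rw [key]
  rw [← (finTwoArrowEquiv (Fin (q + 1))).symm.sum_comp]
  simp only [finTwoArrowEquiv_symm_apply, Matrix.cons_val_zero, Matrix.cons_val_one]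
  rcases h0 : cwAlpha q (b 0) (c 0) with _ | x <;> rcases h1 : cwAlpha q (b 1) (c 1) with _ | y
  · simp
  · simp
  · simp
  · simp only [Option.some.injEq]
    rw [Fintype.sum_eq_single (x, y)]
    · simp
    · rintro ⟨x', y'⟩ hne
      have : ¬ (x = x' ∧ y = y') := fun h => hne (by rw [h.1, h.2])
      by_cases hx : x = x'
      · have hy : ¬ y = y' := fun hy => this ⟨hx, hy⟩
        simp [hy]
      · simp [hx]

/-- The `j`-th coordinate of `φ₂` of the slice of `T_{cw,q}^{⊠2}` at `(b, c)`, as a `sliceVal`.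
[cite: ConnerGesmundoLandsbergVentura2022, Thm. 3.3 (proof)] -/
theorem cglvPhi2_slice (j : Fin 3) (b c : Fin 2 → Fin (q + 1)) :
    ∑ a, cglvPhi2 R q j a * kroneckerPow (cwTensor R q) 2 a b c =
      sliceVal R q j (cwAlpha q (b 0) (c 0)) (cwAlpha q (b 1) (c 1)) := by
  rw [sum_mul_kroneckerPow_two]
  rcases cwAlpha q (b 0) (c 0) with _ | x <;> rcases cwAlpha q (b 1) (c 1) with _ | y <;>
    simp [sliceVal, cglvPhi2_eq_phi2Val]

/-- `Φ₀((c₀,c₁),(b₀,b₁)) = φ₀(α(b₀,c₀), α(b₁,c₁))`. [cite: ConnerGesmundoLandsbergVentura2022, Thm. 3.3 (proof)] -/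
theorem Phi0_apply (b0 b1 c0 c1 : Fin (q + 1)) :
    Phi0 R q (c0, c1) (b0, b1) = sliceVal R q 0 (cwAlpha q b0 c0) (cwAlpha q b1 c1) := by
  simp only [Phi0, Matrix.kroneckerMap_apply, Matrix.add_apply, opD_eq, opG_eq one_ne_zero]
  rcases cwAlpha q b0 c0 with _ | x
  · simp [sliceVal]
  rcases cwAlpha q b1 c1 with _ | y
  · simp [sliceVal]
  simp only [sliceVal, phi2Val, Fin.val_zero, if_true]
  split_ifs <;> first | (exfalso; omega) | norm_num

/-- `Φ₁((c₀,c₁),(b₀,b₁)) = φ₁(α(b₀,c₀), α(b₁,c₁))`. [cite: ConnerGesmundoLandsbergVentura2022, Thm. 3.3 (proof)] -/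
theorem Phi1_apply (b0 b1 c0 c1 : Fin (q + 1)) :
    Phi1 R q (c0, c1) (b0, b1) = sliceVal R q 1 (cwAlpha q b0 c0) (cwAlpha q b1 c1) := by
  simp only [Phi1, Matrix.kroneckerMap_apply, Matrix.add_apply, Matrix.sub_apply, opD_eq, opS_eq]
  rcases cwAlpha q b0 c0 with _ | x
  · simp [sliceVal]
  rcases cwAlpha q b1 c1 with _ | y
  · simp [sliceVal]
  simp only [sliceVal, phi2Val, Fin.val_one, one_ne_zero, if_false, if_true]
  split_ifs <;> first | (exfalso; omega) | norm_num

/-- `Φ₂((c₀,c₁),(b₀,b₁)) = φ₂(α(b₀,c₀), α(b₁,c₁))`. [cite: ConnerGesmundoLandsbergVentura2022, Thm. 3.3 (proof)] -/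
theorem Phi2_apply (b0 b1 c0 c1 : Fin (q + 1)) :
    Phi2 R q (c0, c1) (b0, b1) = sliceVal R q 2 (cwAlpha q b0 c0) (cwAlpha q b1 c1) := by
  simp only [Phi2, Matrix.kroneckerMap_apply, Matrix.add_apply, opD_eq, opG_eq one_ne_zero,
    opG_eq two_ne_zero, opG_eq three_ne_zero]
  rcases cwAlpha q b0 c0 with _ | x
  · simp [sliceVal]
  rcases cwAlpha q b1 c1 with _ | y
  · simp [sliceVal]
  simp only [sliceVal, phi2Val, Fin.val_two, show ¬ ((2 : ℕ) = 0) from by decide,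
    show ¬ ((2 : ℕ) = 1) from by decide, if_false]
  split_ifs <;> first | (exfalso; omega) | norm_num

/-- `Φ_j((c₀,c₁),(b₀,b₁)) = φ_j(α(b₀,c₀), α(b₁,c₁))`. [cite: ConnerGesmundoLandsbergVentura2022, Thm. 3.3 (proof)] -/
theorem PhiJ_apply (j : Fin 3) (b0 b1 c0 c1 : Fin (q + 1)) :
    PhiJ R q j (c0, c1) (b0, b1) = sliceVal R q j (cwAlpha q b0 c0) (cwAlpha q b1 c1) := by
  rcases j with ⟨j, hj⟩
  have : j = 0 ∨ j = 1 ∨ j = 2 := by omega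
  rcases this with rfl | rfl | rfl
  · simpa [PhiJ] using Phi0_apply (R := R) b0 b1 c0 c1
  · simpa [PhiJ] using Phi1_apply (R := R) b0 b1 c0 c1
  · simpa [PhiJ] using Phi2_apply (R := R) b0 b1 c0 c1

/-! ## The Kronecker form -/

/-- The relabelling of pair indices `(Fin 2 → X) ≃ X × X` on rows (`k = 2`) and columns
(`k = 1`). [folklore] -/
def pairEquiv (q : ℕ) (k : ℕ) :
    PSub 3 k × (Fin 2 → Fin (q + 1)) ≃ PSub 3 k × (Fin (q + 1) × Fin (q + 1)) :=
  (Equiv.refl _).prodCongr (finTwoArrowEquiv _)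

/-- **The Kronecker form of the flattening**: after relabelling pair indices,
`koszulFlattening 1 (φ₂) (T_{cw,q}^{⊠2}) = ∑_j Inc_j ⊗ Φ_j`.
[cite: ConnerGesmundoLandsbergVentura2022, Thm. 3.3 (proof)] -/
theorem koszulFlattening_cglvPhi2_reindex :
    (koszulFlattening 1 (cglvPhi2 R q).mulVecLin (kroneckerPow (cwTensor R q) 2)).reindex
        (pairEquiv q 2) (pairEquiv q 1) = Kx R q := by
  ext ⟨T, c0, c1⟩ ⟨S, b0, b1⟩
  simp only [Matrix.reindex_apply, Matrix.submatrix_apply, pairEquiv, Equiv.prodCongr_symm,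
    Equiv.prodCongr_apply, Prod.map_apply, Equiv.refl_symm, Equiv.refl_apply,
    finTwoArrowEquiv_symm_apply, koszulFlattening_apply, wedgeMatrix_apply,
    Matrix.mulVecLin_apply, Matrix.mulVec, dotProduct, Kx, Matrix.sum_apply,
    Matrix.kroneckerMap_apply, incMat]
  refine Finset.sum_congr rfl fun j _ => ?_
  rw [cglvPhi2_slice, PhiJ_apply]
  simp only [Matrix.cons_val_zero, Matrix.cons_val_one]
  split_ifs <;> simp

end CGLVThm33

end Literature.Computability.AlgebraicComplexity

end
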